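import Literature.Probability.Distributions.IndepProductLaw
import Mathlib.Probability.Independence.Basic
import Mathlib.Probability.HasLaw
import HarnessLib

/-!
# The independent product law `indepLaw` as a product measure: independence and marginals

Topic `Probability/Distributions`; theorems-only bridge between the `PMF` product
`indepLaw K p : PMF (Fin K → α)` (`IndepProductLaw.lean`, arbitrary laws `p j` on a countable
type `α` with measurable singletons — e.g. a lattice `Λ ⊂ ℝⁿ`) and Mathlib's measure-theoretic
independence API (`Measure.pi`, `ProbabilityTheory.iIndepFun`, `ProbabilityTheory.HasLaw`), in
the direction a `PMF`-level (bit-level, machine) assembly needs in order to invoke analytic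
estimates proved for "independent `yᵢ` with laws `D_{Λ,s,cᵢ}` under a probability measure `P`"
(e.g. `Literature/Algebra/EuclideanLattices/MRIncGDDSuccess.lean`, `MRGapCVPWitness.lean`, the
conditional analyses of Micciancio–Regev 2007 Thm. 5.9 and Thm. 5.23): take
`P = (indepLaw K p).toMeasure` and `yⱼ = eval j`.

* `toMeasure_indepLaw` — `(⨂ⱼ pⱼ).toMeasure = Measure.pi (j ↦ (pⱼ).toMeasure)`;
  `toOuterMeasure_indepLaw_eq_pi` — the mass of ANY set is its product measure;
* `iIndepFun_eval_indepLaw` — the coordinates `v ↦ v j` are independent under `(⨂ⱼ pⱼ).toMeasure`;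
* `hasLaw_eval_indepLaw` — the `j`-th coordinate has law `(pⱼ).toMeasure`;
* `measureReal_indepLaw_eq_toReal` — `(⨂ⱼ pⱼ).toMeasure.real s = ((⨂ⱼ pⱼ) s).toReal`, the form in
  which `P.real {…} ≤ θ` estimates are read back at the `PMF` level.

The finite-type analogue (`piLaw`, `toMeasure_piLaw`) is in `FiniteProductLaws.lean`.

## References

* W. Feller, *An Introduction to Probability Theory and Its Applications I*, 3rd ed., Wiley 1968,
  Ch. IX §1 (independent trials and product probabilities) [folklore].
-/

noncomputable section

namespace Literature.Probability.Distributions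

open _root_.MeasureTheory _root_.ProbabilityTheory
open scoped ENNReal

variable {α : Type*} [MeasurableSpace α] [MeasurableSingletonClass α] [Countable α]

/-- **The measure of `⨂ⱼ pⱼ` is the product measure** (both give mass `∏ⱼ pⱼ(vⱼ)` to the
singleton `{v}`, and the space is countable). [folklore] -/
theorem toMeasure_indepLaw (K : ℕ) (p : Fin K → PMF α) :
    (indepLaw K p).toMeasure = Measure.pi fun j => (p j).toMeasure := by
  refine Measure.ext_of_singleton fun v => ?_
  rw [PMF.toMeasure_apply_singleton _ _ (measurableSet_singleton _), indepLaw_apply,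
    ← Set.univ_pi_singleton v, Measure.pi_pi]
  exact Finset.prod_congr rfl fun j _ =>
    (PMF.toMeasure_apply_singleton _ _ (measurableSet_singleton _)).symm

/-- `toOuterMeasure` form: the mass `⨂ⱼ pⱼ` gives to ANY set of tuples is its product measure.
[folklore] -/
theorem toOuterMeasure_indepLaw_eq_pi (K : ℕ) (p : Fin K → PMF α) (s : Set (Fin K → α)) :
    (indepLaw K p).toOuterMeasure s = Measure.pi (fun j => (p j).toMeasure) s := by
  rw [← toMeasure_indepLaw, PMF.toMeasure_apply_eq_toOuterMeasure]

omit [Countable α] in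
/-- Real-valued form: `(⨂ⱼ pⱼ).toMeasure.real s = ((⨂ⱼ pⱼ) s).toReal` for every set `s`. [folklore] -/
theorem measureReal_indepLaw_eq_toReal (K : ℕ) (p : Fin K → PMF α) (s : Set (Fin K → α)) :
    (indepLaw K p).toMeasure.real s = ((indepLaw K p).toOuterMeasure s).toReal := by
  rw [measureReal_def, PMF.toMeasure_apply_eq_toOuterMeasure]

/-- **The coordinates of `⨂ⱼ pⱼ` are independent random variables** on the probability space
`((Fin K → α), (⨂ⱼ pⱼ).toMeasure)`. [folklore] -/
theorem iIndepFun_eval_indepLaw (K : ℕ) (p : Fin K → PMF α) :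
    iIndepFun (fun (j : Fin K) (v : Fin K → α) => v j) (indepLaw K p).toMeasure := by
  rw [toMeasure_indepLaw]
  exact iIndepFun_pi (X := fun _ (a : α) => a) fun _ => aemeasurable_id

/-- **The `j`-th coordinate of `⨂ⱼ pⱼ` has law `pⱼ`.** [folklore] -/
theorem hasLaw_eval_indepLaw (K : ℕ) (p : Fin K → PMF α) (j : Fin K) :
    HasLaw (fun v : Fin K → α => v j) (p j).toMeasure (indepLaw K p).toMeasure := by
  rw [toMeasure_indepLaw]
  exact ⟨(measurable_pi_apply j).aemeasurable,
    (measurePreserving_eval (fun j => (p j).toMeasure) j).map_eq⟩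

end Literature.Probability.Distributions

end
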